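import Mathlib
import HarnessLib

/-!
# Weil-type family coverage — the ℤ/m TYPE THEOREM in eigenvalue form (Möbius bookkeeping) and the dicyclic parity

research route conditional on HC_CM; not a corollary; Q11.4-sentence-2 already refuted in dim ≥ 3.

Ring 2, WEIL-TYPE FAMILY-COVERAGE CENSUS (`HOME/WEIL-FAMILY-COVERAGE.md` `## b04`, block b04.9, owner ring2-b04).
Ring2-b04 g43's THEOREM T gives the `p`-adic valuation of the polarisation type `(d₁, …, d_h)` of the primitive piece
`B_m` of a `ℤ/m`-cover `C̃ → X` (generator `σ`, `p^a ∥ m = p^a·s`, `s > 1`) as a MÖBIUS SUM OF GENERA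
`v_p(d₁⋯d_h) = Σ_{t ∣ s} μ(s/t)·g(C̃/⟨σ^{p^{a-1}t}⟩)`.  Writing `V_k := ker Φ_k(σ) ⊂ H¹(C̃, ℚ)` (`k ∣ m`) and
`2·g(C̃/⟨σ^j⟩) = dim Fix(σ^j) = Σ_{k ∣ j} dim V_k`, that sum collapses to the EIGENVALUE FORM (block b04.9 THEOREM T″)
`v_p(d₁⋯d_h) = ½·Σ_{c<a} dim V_{s·p^c}` — «half the dimension of the part of `H¹(C̃)` on which `σ^{p^a}` has exact
order `s` and `σ` has order `< m`», equivalently the dimension of the primitive Prym of the residual degree-`s` cyclic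
cover `C̃/⟨σ^{m/p}⟩ → C̃/⟨σ^{p^{a-1}}⟩`.  The collapse is pure divisor-lattice bookkeeping — Möbius inversion on the
divisor-closed set of integers prime to `p` — and is what this file proves (§1), for an ARBITRARY function
`V : ℕ → ℤ` in place of `k ↦ dim V_k`:

* `sum_divisors_prime_pow_mul` : `Σ_{d ∣ p^r·t} V d = Σ_{d' ∣ t} Σ_{c ≤ r} V (p^c·d')` for `p ∤ t`;
* `sum_moebius_mul_sum_divisors_eq` : `Σ_{t ∣ s} μ(s/t)·(Σ_{d ∣ p^{a-1}t} V d) = Σ_{c<a} V (p^c·s)` for `p ∤ s`, `a ≥ 1`.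

§2 is the arithmetic shell of block b04.9's DICYCLIC PARITY THEOREM: in a `Dic_n`-cover the sub-pieces `V_k` with `2n/k`
odd are modules over the quaternionic quotient `Dic_{k/2}` (Frobenius–Schur indicator `-1`, rational Schur index `2`), so
`2·φ(k) ∣ dim V_k`; since `φ(k)` is even for `k ≥ 3` (`Nat.totient_even`), `4 ∣ dim V_k`, and the eigenvalue form then makes
`v_p` EVEN whenever every summand is such a piece (`even_of_two_mul_eq_sum_of_four_dvd`,
`four_dvd_two_mul_totient`) — e.g. `v₃` of every `Dic₆` quaternion Prym, `v₅` of every `Dic₁₀` one.  The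
representation-theoretic input (`2φ(k) ∣ dim V_k`) is NOT formalised here; it enters the census sentences as a hypothesis.

Mathlib only (`ArithmeticFunction.sum_eq_iff_sum_mul_moebius_eq_on`, `Nat.Coprime.divisors_mul`,
`Nat.sum_divisors_prime_pow`, `Nat.totient_even`); no `def`, no named fact, no `sorry`; nothing here is a statement about
Hodge classes; `HC_CM` is used nowhere.  References: [cite: LangeRodriguez2022, Prop. 3.2.8 and Cor. 6.1.9, 6.1.12] for the
prime-degree input of THEOREM T; [cite: Apostol1976, Thm 2.9] for Möbius inversion.
-/

set_option linter.dupNamespace false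

open Finset ArithmeticFunction

namespace Summit.HodgeConjecture.HodgeConjecture.Ring2.WeilCoverage

/-! ### §1 Möbius bookkeeping: THEOREM T (Möbius form) = THEOREM T″ (eigenvalue form) -/

/-- **Coprime divisor splitting.** For a prime `p` not dividing `t`, the divisors of `p^r·t` are the products `p^c·d'`
with `c ≤ r`, `d' ∣ t`, bijectively; hence `Σ_{d ∣ p^r t} V d = Σ_{d' ∣ t} Σ_{c ≤ r} V (p^c d')` for any `V` (applied with
`V k = dim V_k`: `dim Fix(σ^{p^r t}) = Σ_{d' ∣ t} Σ_{c ≤ r} dim V_{p^c d'}`).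
research route conditional on HC_CM; not a corollary; Q11.4-sentence-2 already refuted in dim ≥ 3. [cite: Apostol1976, Thm 2.9] -/
theorem sum_divisors_prime_pow_mul {M : Type*} [AddCommMonoid M] {p : ℕ} (hp : p.Prime) (r : ℕ) {t : ℕ}
    (ht : Nat.Coprime (p ^ r) t) (V : ℕ → M) :
    ∑ d ∈ (p ^ r * t).divisors, V d = ∑ d' ∈ t.divisors, ∑ c ∈ range (r + 1), V (p ^ c * d') := by
  rw [Nat.Coprime.divisors_mul ht, Finset.sum_map]
  simp only [Function.Embedding.coeFn_mk]
  have h1 : ∑ x ∈ ((p ^ r).divisors ×ˢ t.divisors).attach, V ((x : ℕ × ℕ).1 * (x : ℕ × ℕ).2) =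
      ∑ x ∈ (p ^ r).divisors ×ˢ t.divisors, V (x.1 * x.2) :=
    Finset.sum_attach ((p ^ r).divisors ×ˢ t.divisors) (fun x => V (x.1 * x.2))
  refine h1.trans ?_
  rw [Finset.sum_product, Nat.sum_divisors_prime_pow hp, Finset.sum_comm]

/-- **THEOREM T″ (Möbius bookkeeping).** For a prime `p`, `a ≥ 1` and `s ≥ 1` with `p ∤ s`, and ANY `V : ℕ → ℤ`:
`Σ_{t ∣ s} μ(s/t) · (Σ_{d ∣ p^{a-1} t} V d) = Σ_{c < a} V (p^c · s)`.
With `V k = dim_ℚ ker Φ_k(σ)` for a `ℤ/(p^a s)`-cover `C̃ → X` (so that `Σ_{d ∣ j} V d = dim Fix(σ^j) = 2 g(C̃/⟨σ^j⟩)`), the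
left side is TWICE ring2-b04 g43's Möbius formula for `v_p(d₁⋯d_h)` of the primitive piece `B_{p^a s}` and the right side is
the dimension of the part of `H¹(C̃,ℚ)` where `σ` has order `s·p^c`, `c < a`: **`v_p(d₁⋯d_h) = ½ Σ_{c<a} dim V_{s p^c}`** —
the eigenvalue form used by block b04.9 (e.g. `m = 12`, `p = 3`: `v₃ = ½ dim V₄`; `p = 2`: `v₂ = ½ (dim V₃ + dim V₆)`).
Proof: Möbius inversion (`ArithmeticFunction.sum_eq_iff_sum_mul_moebius_eq_on`) on the divisor-closed set
`{n : n ⊥ p}` applied to `sum_divisors_prime_pow_mul`.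
research route conditional on HC_CM; not a corollary; Q11.4-sentence-2 already refuted in dim ≥ 3.
[cite: LangeRodriguez2022, Prop. 3.2.8 and Cor. 6.1.9, 6.1.12] [cite: Apostol1976, Thm 2.9] -/
theorem sum_moebius_mul_sum_divisors_eq {p : ℕ} (hp : p.Prime) {a : ℕ} (ha : 0 < a) {s : ℕ} (hs : 0 < s)
    (hps : Nat.Coprime s p) (V : ℕ → ℤ) :
    ∑ t ∈ s.divisors, (moebius (s / t) : ℤ) * (∑ d ∈ (p ^ (a - 1) * t).divisors, V d) =
      ∑ c ∈ range a, V (p ^ c * s) := by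
  have hS : ∀ m n : ℕ, m ∣ n → n ∈ {n : ℕ | Nat.Coprime n p} → m ∈ {n : ℕ | Nat.Coprime n p} :=
    fun m n hmn hn => Nat.Coprime.coprime_dvd_left hmn hn
  have key := (ArithmeticFunction.sum_eq_iff_sum_mul_moebius_eq_on (R := ℤ)
    (f := fun d' => ∑ c ∈ range a, V (p ^ c * d'))
    (g := fun t => ∑ d ∈ (p ^ (a - 1) * t).divisors, V d) {n : ℕ | Nat.Coprime n p} hS).1
    (fun n _ hnp => by
      have hcop : Nat.Coprime (p ^ (a - 1)) n := Nat.Coprime.pow_left (a - 1) (Nat.Coprime.symm hnp)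
      rw [sum_divisors_prime_pow_mul hp (a - 1) hcop V, Nat.sub_add_cancel ha])
    s hs hps
  rw [← Nat.sum_divisorsAntidiagonal' (f := fun x y => (moebius x : ℤ) * ∑ d ∈ (p ^ (a - 1) * y).divisors, V d)]
  exact key

/-- **THEOREM T″, single-step case (`a = 1`, `m = p·s`, `p ∤ s`).** `Σ_{t ∣ s} μ(s/t)·(Σ_{d ∣ t} V d) = V s`:
for `m = p·s` squarefree in `p` the `p`-adic valuation of the type of `B_m` is `½ dim V_s = dim B_s(C̃/⟨σ^s⟩… )`, i.e.
the dimension of the primitive Prym of the degree-`s` quotient cover `C̃/⟨σ^{s}⟩`-tower step `C̃/⟨σ^p⟩^{…}`; for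
`m = 6`: `v₂ = ½ dim V₃ = g(C̃/σ³) - g(X)`, `v₃ = ½ dim V₂ = g(C̃/σ²) - g(X)` (ring2-b04 g42's ℤ/6 TYPE THEOREM), for
`m = 2p` (`Dic_p` quaternion Pryms, b04.9): `v_p = ½ dim V₂ = g(C̃/⟨a²⟩) - g(C̃/⟨a⟩)`.
research route conditional on HC_CM; not a corollary; Q11.4-sentence-2 already refuted in dim ≥ 3. [cite: Apostol1976, Thm 2.9] -/
theorem sum_moebius_mul_sum_divisors_eq_self {p : ℕ} (hp : p.Prime) {s : ℕ} (hs : 0 < s) (hps : Nat.Coprime s p)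
    (V : ℕ → ℤ) :
    ∑ t ∈ s.divisors, (moebius (s / t) : ℤ) * (∑ d ∈ t.divisors, V d) = V s := by
  have h := sum_moebius_mul_sum_divisors_eq hp Nat.one_pos hs hps V
  simpa using h

/-! ### §2 The arithmetic shell of the DICYCLIC PARITY THEOREM -/

/-- `4 ∣ 2·φ(k)` for `k ≥ 3` (`φ(k)` is even): the rational irreducible representation of `Dic_{k/2}` containing a
faithful 2-dimensional character has dimension `2φ(k)`, a multiple of `4`.
research route conditional on HC_CM; not a corollary; Q11.4-sentence-2 already refuted in dim ≥ 3. [folklore] -/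
theorem four_dvd_two_mul_totient {k : ℕ} (hk : 2 < k) : 4 ∣ 2 * Nat.totient k := by
  obtain ⟨j, hj⟩ := Nat.totient_even hk
  exact ⟨j, by omega⟩

/-- **Parity shell.** If `2·v = Σ_{c<a} V (p^c·s)` (THEOREM T″) and every summand is a multiple of `4` (each `V_{s p^c}`
a module over a quaternionic quotient `Dic_{s p^c/2}`: `2φ(s p^c) ∣ dim`, `s p^c ≥ 3`), then `v` is EVEN — block b04.9:
`v_p(type of a Dic_n quaternion Prym)` is even for every odd prime `p` with `n ≠ p^a` (e.g. `v₃` for `Dic₆`, `Dic₁₂`,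
`Dic₁₅`; `v₅` for `Dic₁₀`, `Dic₁₅`), so those primes DROP OUT of the discriminant class `[d₁⋯d_h]`.
research route conditional on HC_CM; not a corollary; Q11.4-sentence-2 already refuted in dim ≥ 3. [folklore] -/
theorem even_of_two_mul_eq_sum_of_four_dvd {a p s : ℕ} {V : ℕ → ℤ} {v : ℤ}
    (hv : 2 * v = ∑ c ∈ range a, V (p ^ c * s)) (h4 : ∀ c ∈ range a, (4 : ℤ) ∣ V (p ^ c * s)) : Even v := by
  have h : (4 : ℤ) ∣ 2 * v := by
    rw [hv]
    exact Finset.dvd_sum h4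
  obtain ⟨w, hw⟩ := h
  exact ⟨w, by omega⟩

/-- **Parity shell, prime-power case (`s = 2`, `n = p^a`).** If `2·v = V 2 + Σ_{1 ≤ c < a} V (2 p^c)` with the `c ≥ 1`
summands multiples of `4`, then `v ≡ ½·V 2 (mod 2)`: for `Dic_{p^a}` the parity of `v_p` is that of
`½ dim V₂ = g(C̃/⟨a²⟩) - g(C̃/⟨a⟩)` (odd for the triangle curves `(0; 4, 4, 2p^a)`: `Dic₅ ↦ 5¹`, `Dic₇ ↦ 7¹`, `Dic₉ ↦ 3³`,
`Dic₁₁ ↦ 11¹`, `Dic₁₃ ↦ 13¹`).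
research route conditional on HC_CM; not a corollary; Q11.4-sentence-2 already refuted in dim ≥ 3. [folklore] -/
theorem even_sub_of_two_mul_eq_sum_of_four_dvd {a p : ℕ} {V : ℕ → ℤ} {v w : ℤ} (ha : 0 < a)
    (hv : 2 * v = ∑ c ∈ range a, V (p ^ c * 2)) (hw : V 2 = 2 * w)
    (h4 : ∀ c ∈ range a, 0 < c → (4 : ℤ) ∣ V (p ^ c * 2)) : Even (v - w) := by
  obtain ⟨a', rfl⟩ : ∃ a', a = a' + 1 := ⟨a - 1, by omega⟩
  rw [Finset.sum_range_succ'] at hv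
  simp only [pow_zero, one_mul] at hv
  have h : (4 : ℤ) ∣ ∑ c ∈ range a', V (p ^ (c + 1) * 2) :=
    Finset.dvd_sum fun c hc => h4 (c + 1) (by simp only [mem_range] at hc ⊢; omega) (Nat.succ_pos c)
  obtain ⟨u, hu⟩ := h
  exact ⟨u, by omega⟩

end Summit.HodgeConjecture.HodgeConjecture.Ring2.WeilCoverage
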